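import Mathlib
import HarnessLib
import Summits.CriticalPhenomena.PercolationContinuityZ3.Theses.PercLowPointHalfSpace
import Literature.Probability.Percolation.HalfSpaceFloorDilution
import Literature.Probability.Percolation.HalfSpacePinnedPairs
import Summits.CriticalPhenomena.PercolationContinuityZ3.Theorems.PercLowPointHalfSpaceLowPointBookkeepingStubPairExpectationAux
import Summits.CriticalPhenomena.PercolationContinuityZ3.Theorems.PercLowPointHalfSpaceLowPointBookkeepingStubPairExpectationAux2

/-!
# Window pair count in expectation: stub `stub_pairExpectation` of line SketchIdeator1
(skeleton floor-russo), crux LowPointBookkeeping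

Helper file for the crux skeleton `Cruxes/LowPointBookkeeping/Lines/SketchIdeator1.lean`
(item `stmt-CriticalPhenomena-14713`,
`Summit.CriticalPhenomena.PercolationContinuityZ3.Theses.PercLowPointHalfSpace.LowPointBookkeeping`).
Proves EXACTLY the registered stub signature `stub_pairExpectation`; no new definition.

## The statement

Write `ℍ = {x ∈ ℤ³ | 0 ≤ x₀}`, `P_s` for the floor-diluted critical half-space measure
`floorDilutedPercolation 3 p_c s`, `x ↔ y` for `ω ∈ openConnIn ℍ x y`, `e` for one of the four
floor neighbours of `0`, `W_L = B_L + 2L e₀` for the window, `m₀(n) = #{y ∈ B_n | 0 ↔ y}`,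
`m_e(n) = #{y ∈ B_n | e ↔ e + y}` and `A(r)` for the two-arm event (two `r`-tall ℍ-disjoint
ℍ-clusters at `0` and `e`). Given `0 < κ ≤ 1/4`, `C₁ ≥ 0`, `C₂ > 0` and the deterministic dyadic
bound `hcount` of the pair count (stub `stub_pairCount`, entering only as a hypothesis), there is a
constant `C = C(κ, C₁, C₂)` such that for every floor density `s` and neighbour `e` satisfying the
two-arm bound `P_s(A(r)) ≤ C₁ r^{-(11/4+κ)}` (`hA`) and the mass tails
`P_s(m_x(n) ≥ t C₂ n^{11/4}) ≤ e^{3/2} e^{-t/2}` for `x ∈ {0, e}`, `t ≥ 1` (`hT`), and every `L ≥ 1`,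
`Σ_{w ∈ W_L} Σ_{v : v₀ ≥ 1} P_s(0 ↔ v, e ↔ v + w, 0 ↮ e) ≤ C L^{3-κ/2}`.

## Proof

* Tonelli (`sum_tsum_measure_eq_lintegral`): the left side is `∫ (pair count) dP_s`, bounded via
  `hcount` by `∫ near dP_s + ∫ far dP_s` (masses and two-arm events are measurable,
  `measurable_ncard_box_inter`, `measurableSet_twoArm`).
* Near class `j` (`2^j < 8L`, `near_class_le`): the two-factor Markov truncation
  (`lintegral_mul_mul_indicator_le`, file `…Aux`) at thresholds `Λ C₂ n^{11/4}`, `Λ = 1 + 10 log L`,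
  with `hA` at scale `min(2^j, L)` and `hT` at `(0, 2^{j+1})`, `(e, 20L)`, then the real inequality
  `near_real` (file `…Aux2`): `≤ K_near L^{3-κ/2} (2^{-κ})^j`.
* Far class `j` (`8L ≤ 2^j`, `far_class_le`): the one-factor truncation
  (`lintegral_mul_const_indicator_le`) at threshold `T C₂ n^{11/4}`, `T = 1 + 8 log 2^{j-1}`, with
  `hA` at scale `2^{j-1}`, `hT` at `(0, 2^{j+1})` and `|W_L| ≤ (2L+1)^3`, then `far_real`:
  `≤ K_far L^{3-κ/2} (2^{-κ/4})^j`.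
* Geometric sums over the classes (`lintegral_sum_le_of_geom`, `lintegral_tsum_le_of_geom`) and
  assembly (`expectation_le_of_classes`):
  `C = K_near / (1 - 2^{-κ}) + K_far / (1 - 2^{-κ/4})`, chosen before `s` and `e`.
-/

noncomputable section

namespace Summit.CriticalPhenomena.PercolationContinuityZ3.Theorems.FloorRusso

open MeasureTheory Filter Topology
open Literature.Probability.Percolation Literature.Probability.LatticeModels
open scoped ENNReal

/-- The closed half-space `ℍ = {x₀ ≥ 0}` of `ℤ³` (local notation). -/
local notation3 (prettyPrint := false) "ℍ₃" => ({x : Site 3 | 0 ≤ x 0} : Set (Site 3))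

/-- The window `W_L = B_L + 2L e₀` (local notation). -/
local notation3 (prettyPrint := false) "𝑾⟦" L "⟧" =>
  (Finset.image (fun y : Site 3 => y + Pi.single 0 (((2 * L : ℕ)) : ℤ)) (box 3 L))

/-- The counted event `{0 ↔ v} ∩ {e ↔ v + w} ∩ {0 ↮ e}` (local notation). -/
local notation3 (prettyPrint := false) "𝑬⟦" e ", " v ", " w "⟧" =>
  (openConnIn ℍ₃ 0 v ∩ openConnIn ℍ₃ e (v + w) ∩ (openConnIn ℍ₃ 0 e)ᶜ)

/-- The two-arm event `A(r)` at the adjacent roots `0, e` (local notation). -/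
local notation3 (prettyPrint := false) "𝑨⟦" e ", " r "⟧" =>
  ({ω | ∃ y : Site 3, (∃ i : Fin 3, ((r : ℕ) : ℤ) ≤ |y i|) ∧ ω ∈ openConnIn ℍ₃ 0 y} ∩
    {ω | ∃ y : Site 3, (∃ i : Fin 3, ((r : ℕ) : ℤ) ≤ |y i - e i|) ∧ ω ∈ openConnIn ℍ₃ e y} ∩
      (openConnIn ℍ₃ 0 e)ᶜ)

/-- The set of points of `B_n` joined to `0` in `ℍ` (local notation; `m₀(n)` is its `ncard`). -/
local notation3 (prettyPrint := false) "𝑪₀⟦" ω ", " n "⟧" =>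
  (((↑(box 3 n)) : Set (Site 3)) ∩ {y : Site 3 | ω ∈ openConnIn ℍ₃ 0 y})

/-- The set of offsets `y ∈ B_n` with `e ↔ e + y` in `ℍ` (local notation; `m_e(n)` is its `ncard`). -/
local notation3 (prettyPrint := false) "𝑪⟦" ω ", " e ", " n "⟧" =>
  (((↑(box 3 n)) : Set (Site 3)) ∩ {y : Site 3 | ω ∈ openConnIn ℍ₃ e (e + y)})

/-- The near-class integrand `m₀(2^{j+1}) m_e(20L) 1[A(min(2^j, L))]` (local notation). -/
local notation3 (prettyPrint := false) "𝒏⟦" e ", " L ", " j ", " ω "⟧" =>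
  (((𝑪₀⟦ω, 2 ^ (j + 1)⟧).ncard : ℝ≥0∞) * ((𝑪⟦ω, e, 20 * L⟧).ncard : ℝ≥0∞) *
    (𝑨⟦e, min (2 ^ j) L⟧).indicator (fun _ => (1 : ℝ≥0∞)) ω)

/-- The far-class integrand `m₀(2^{j+1}) |W_L| 1[A(2^{j-1})]` (local notation). -/
local notation3 (prettyPrint := false) "𝒇⟦" e ", " L ", " j ", " ω "⟧" =>
  (((𝑪₀⟦ω, 2 ^ (j + 1)⟧).ncard : ℝ≥0∞) * ((𝑾⟦L⟧).card : ℝ≥0∞) *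
    (𝑨⟦e, 2 ^ (j - 1)⟧).indicator (fun _ => (1 : ℝ≥0∞)) ω)

namespace PairExpectation

/-! ## Measurability and boundedness of the masses and the two-arm events -/

/-- The two-arm event is measurable. -/
theorem measurableSet_twoArm (e : Site 3) (r : ℕ) :
    MeasurableSet (𝑨⟦e, r⟧ : Set (BondConfig (Site 3))) := by
  refine (MeasurableSet.inter ?_ ?_).inter (measurableSet_openConnIn_of_countable _ _ _).compl
  · exact measurableSet_setOf.2 (Measurable.exists fun y => measurable_const.and
      (measurable_mem.2 (measurableSet_openConnIn_of_countable _ _ y)))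
  · exact measurableSet_setOf.2 (Measurable.exists fun y => measurable_const.and
      (measurable_mem.2 (measurableSet_openConnIn_of_countable _ _ y)))

/-- The masses `#{y ∈ B_n | a(y) ↔ b(y) in ℍ}` are measurable functions of the configuration. -/
theorem measurable_ncard_box_inter (n : ℕ) (f : Site 3 → Site 3 × Site 3) :
    Measurable fun ω : BondConfig (Site 3) =>
      ((((↑(box 3 n)) : Set (Site 3)) ∩
        {y : Site 3 | ω ∈ openConnIn ℍ₃ (f y).1 (f y).2}).ncard : ℝ≥0∞) := by
  refine measurable_from_nat.comp (measurable_ncard.comp (measurable_set_iff.2 fun y => ?_))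
  exact measurable_const.and (measurable_mem.2 (measurableSet_openConnIn_of_countable _ _ _))

/-- The masses are bounded by the box volume. -/
theorem ncard_box_inter_le (n : ℕ) (P : Site 3 → Prop) :
    ((((↑(box 3 n)) : Set (Site 3)) ∩ {y : Site 3 | P y}).ncard) ≤ (box 3 n).card :=
  (Set.ncard_inter_le_ncard_left _ _ (Finset.finite_toSet _)).trans_eq (Set.ncard_coe_finset _)

/-- Measurability of the near-class integrand. -/
theorem measurable_near (e : Site 3) (L j : ℕ) :
    Measurable fun ω : BondConfig (Site 3) => if 2 ^ j < 8 * L then 𝒏⟦e, L, j, ω⟧ else 0 := by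
  by_cases h : 2 ^ j < 8 * L
  · simp only [if_pos h]
    exact ((measurable_ncard_box_inter _ fun y => (0, y)).mul
      (measurable_ncard_box_inter _ fun y => (e, e + y))).mul
        (measurable_const.indicator (measurableSet_twoArm e _))
  · simp only [if_neg h]
    exact measurable_const

/-- Measurability of the far-class integrand. -/
theorem measurable_far (e : Site 3) (L j : ℕ) :
    Measurable fun ω : BondConfig (Site 3) => if 8 * L ≤ 2 ^ j then 𝒇⟦e, L, j, ω⟧ else 0 := by
  by_cases h : 8 * L ≤ 2 ^ j
  · simp only [if_pos h]
    exact ((measurable_ncard_box_inter _ fun y => (0, y)).mul measurable_const).mul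
      (measurable_const.indicator (measurableSet_twoArm e _))
  · simp only [if_neg h]
    exact measurable_const

/-- The counted event `{0 ↔ v} ∩ {e ↔ v + w} ∩ {0 ↮ e}` is measurable. -/
theorem measurableSet_pairEvent (e v w : Site 3) :
    MeasurableSet (𝑬⟦e, v, w⟧ : Set (BondConfig (Site 3))) :=
  ((measurableSet_openConnIn_of_countable _ _ _).inter
    (measurableSet_openConnIn_of_countable _ _ _)).inter
      (measurableSet_openConnIn_of_countable _ _ _).compl

/-! ## The class bounds in expectation -/

section Classes

variable {κ C₁ C₂ : ℝ} (hκ : 0 < κ) (hκ4 : κ ≤ 1 / 4) (hC₁ : 0 ≤ C₁) (hC₂ : 0 < C₂)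
  (μ : Measure (BondConfig (Site 3))) [IsProbabilityMeasure μ] (e : Site 3)
  (hA : ∀ r : ℕ, 1 ≤ r → μ.real (𝑨⟦e, r⟧) ≤ C₁ * (r : ℝ) ^ (-(11 / 4 + κ)))
  (hT0 : ∀ n : ℕ, 1 ≤ n → ∀ t : ℝ, 1 ≤ t →
    μ.real {ω | t * (C₂ * (n : ℝ) ^ ((11 : ℝ) / 4)) ≤ ((𝑪₀⟦ω, n⟧).ncard : ℝ)} ≤
      Real.exp (3 / 2) * Real.exp (-t / 2))
  {L : ℕ} (hL : 1 ≤ L)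

include hκ hκ4 hC₁ hC₂ hA hT0 hL

/-- **Near class in expectation**: `E[m₀(2^{j+1}) m_e(20L) 1_{A(min(2^j,L))}] ≤ K_near L^{3-κ/2} 2^{-jκ}`
(two-factor Markov truncation at `Λ C₂ n^{11/4}`, `Λ = 1 + 10 log L`, then `near_real`). -/
theorem near_class_le
    (hTe : ∀ n : ℕ, 1 ≤ n → ∀ t : ℝ, 1 ≤ t →
      μ.real {ω | t * (C₂ * (n : ℝ) ^ ((11 : ℝ) / 4)) ≤ ((𝑪⟦ω, e, n⟧).ncard : ℝ)} ≤
        Real.exp (3 / 2) * Real.exp (-t / 2))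
    {j : ℕ} (hj : 2 ^ j < 8 * L) :
    ∫⁻ ω, 𝒏⟦e, L, j, ω⟧ ∂μ ≤
      ENNReal.ofReal ((2 * 161 ^ 2 * (16 : ℝ) ^ ((11 : ℝ) / 4) * (20 : ℝ) ^ ((11 : ℝ) / 4) *
          C₁ * C₂ ^ 2 + 4 * Real.exp (3 / 2) * 33 ^ 3 * 41 ^ 3) *
        (L : ℝ) ^ (3 - κ / 2) * ((2 : ℝ) ^ (-κ)) ^ j) := by
  have hL1 : (1 : ℝ) ≤ L := by exact_mod_cast hL
  have hΛ1 : (1 : ℝ) ≤ 1 + 10 * Real.log L := by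
    have := Real.log_nonneg hL1
    linarith
  have hm1 : 1 ≤ min (2 ^ j) L := le_min Nat.one_le_two_pow hL
  have hn1 : 1 ≤ 2 ^ (j + 1) := Nat.one_le_two_pow
  have h20 : 1 ≤ 20 * L := by omega
  have key := lintegral_mul_mul_indicator_le μ (fun ω => (𝑪₀⟦ω, 2 ^ (j + 1)⟧).ncard)
    (fun ω => (𝑪⟦ω, e, 20 * L⟧).ncard) (measurableSet_twoArm e (min (2 ^ j) L))
    (fun ω => ncard_box_inter_le _ _) (fun ω => ncard_box_inter_le _ _)
    (mul_nonneg (zero_le_one.trans hΛ1) (by positivity))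
    (mul_nonneg (zero_le_one.trans hΛ1) (by positivity))
    (hA (min (2 ^ j) L) hm1) (hT0 (2 ^ (j + 1)) hn1 _ hΛ1) (hTe (20 * L) h20 _ hΛ1)
  exact key.trans (ENNReal.ofReal_le_ofReal (near_real hκ hκ4 hC₁ hC₂ hL hj))

/-- **Far class in expectation**: `E[m₀(2^{j+1}) |W_L| 1_{A(2^{j-1})}] ≤ K_far L^{3-κ/2} 2^{-jκ/4}`
(one-factor Markov truncation at `T C₂ n^{11/4}`, `T = 1 + 8 log 2^{j-1}`, then `far_real`). -/
theorem far_class_le {j : ℕ} (hj : 8 * L ≤ 2 ^ j) :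
    ∫⁻ ω, 𝒇⟦e, L, j, ω⟧ ∂μ ≤
      ENNReal.ofReal ((2 * (36 * 28 * (4 : ℝ) ^ ((11 : ℝ) / 4) * C₁ * C₂ / κ +
        729 * 27 * Real.exp (3 / 2))) * (L : ℝ) ^ (3 - κ / 2) * ((2 : ℝ) ^ (-κ / 4)) ^ j) := by
  have hK : (𝑾⟦L⟧).card ≤ (2 * L + 1) ^ 3 := Finset.card_image_le.trans (card_box 3 L).le
  have hr1 : 1 ≤ 2 ^ (j - 1) := Nat.one_le_two_pow
  have hn1 : 1 ≤ 2 ^ (j + 1) := Nat.one_le_two_pow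
  have hT1 : (1 : ℝ) ≤ 1 + 8 * Real.log ((2 ^ (j - 1) : ℕ) : ℝ) := by
    have h1 : (1 : ℝ) ≤ ((2 ^ (j - 1) : ℕ) : ℝ) := by exact_mod_cast hr1
    have := Real.log_nonneg h1
    linarith
  have key := lintegral_mul_const_indicator_le μ (fun ω => (𝑪₀⟦ω, 2 ^ (j + 1)⟧).ncard)
    (𝑾⟦L⟧).card (measurableSet_twoArm e (2 ^ (j - 1))) (fun ω => ncard_box_inter_le _ _)
    (mul_nonneg (zero_le_one.trans hT1) (by positivity))
    (hA (2 ^ (j - 1)) hr1) (hT0 (2 ^ (j + 1)) hn1 _ hT1)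
  exact key.trans (ENNReal.ofReal_le_ofReal (far_real hκ hκ4 hC₁ hC₂ hL hj hK))

end Classes

/-- **Tonelli** for the window pair count: `Σ_w Σ_v P(E_{v,w}) = ∫ Σ_w Σ_v 1[E_{v,w}] dP`. -/
theorem sum_tsum_measure_eq_lintegral (μ : Measure (BondConfig (Site 3))) (e : Site 3)
    (W : Finset (Site 3)) :
    ∑ w ∈ W, ∑' v : {v : Site 3 // 1 ≤ v 0}, μ (𝑬⟦e, (v : Site 3), w⟧) =
      ∫⁻ ω, ∑ w ∈ W, ∑' v : {v : Site 3 // 1 ≤ v 0},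
        (𝑬⟦e, (v : Site 3), w⟧).indicator (fun _ => (1 : ℝ≥0∞)) ω ∂μ := by
  have hind : ∀ v w : Site 3, Measurable fun ω : BondConfig (Site 3) =>
      (𝑬⟦e, v, w⟧).indicator (fun _ => (1 : ℝ≥0∞)) ω :=
    fun v w => measurable_const.indicator (measurableSet_pairEvent e v w)
  rw [lintegral_finsetSum _ fun w _ =>
    Measurable.tsum fun v : {v : Site 3 // 1 ≤ v 0} => hind (v : Site 3) w]
  refine Finset.sum_congr rfl fun w _ => ?_
  rw [lintegral_tsum fun v : {v : Site 3 // 1 ≤ v 0} => (hind (v : Site 3) w).aemeasurable]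
  refine tsum_congr fun v => ?_
  rw [lintegral_indicator_const (measurableSet_pairEvent e (v : Site 3) w), one_mul]

/-- **Assembly**: Tonelli, the deterministic count `hcount`, and geometric class bounds
`∫ (near class j) ≤ K_n x^j` (`2^j < 8L`), `∫ (far class j) ≤ K_f z^j` (`8L ≤ 2^j`) give
`Σ_w Σ_v P(0 ↔ v, e ↔ v + w, 0 ↮ e) ≤ K_n/(1-x) + K_f/(1-z)`. -/
theorem expectation_le_of_classes (μ : Measure (BondConfig (Site 3))) (e : Site 3) (L : ℕ)
    {Kn Kf x z : ℝ} (hKn : 0 ≤ Kn) (hKf : 0 ≤ Kf) (hx0 : 0 ≤ x) (hx1 : x < 1) (hz0 : 0 ≤ z)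
    (hz1 : z < 1)
    (hnear : ∀ j : ℕ, 2 ^ j < 8 * L → ∫⁻ ω, 𝒏⟦e, L, j, ω⟧ ∂μ ≤ ENNReal.ofReal (Kn * x ^ j))
    (hfar : ∀ j : ℕ, 8 * L ≤ 2 ^ j → ∫⁻ ω, 𝒇⟦e, L, j, ω⟧ ∂μ ≤ ENNReal.ofReal (Kf * z ^ j))
    (hcount : ∀ ω : BondConfig (Site 3),
      (∑ w ∈ 𝑾⟦L⟧, ∑' v : {v : Site 3 // 1 ≤ v 0},
          (𝑬⟦e, (v : Site 3), w⟧).indicator (fun _ => (1 : ℝ≥0∞)) ω) ≤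
        (∑ j ∈ Finset.range (8 * L), if 2 ^ j < 8 * L then 𝒏⟦e, L, j, ω⟧ else 0) +
          (∑' j : ℕ, if 8 * L ≤ 2 ^ j then 𝒇⟦e, L, j, ω⟧ else 0)) :
    ∑ w ∈ 𝑾⟦L⟧, ∑' v : {v : Site 3 // 1 ≤ v 0}, μ (𝑬⟦e, (v : Site 3), w⟧) ≤
      ENNReal.ofReal (Kn * (1 - x)⁻¹ + Kf * (1 - z)⁻¹) := by
  have hn : ∫⁻ ω, (∑ j ∈ Finset.range (8 * L), if 2 ^ j < 8 * L then 𝒏⟦e, L, j, ω⟧ else 0) ∂μ ≤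
      ENNReal.ofReal (Kn * (1 - x)⁻¹) := by
    refine lintegral_sum_le_of_geom _ (measurable_near e L) hKn hx0 hx1 (fun j => ?_) (8 * L)
    by_cases hj : 2 ^ j < 8 * L
    · simp only [if_pos hj]
      exact hnear j hj
    · simp only [if_neg hj, lintegral_zero]
      exact zero_le
  have hf : ∫⁻ ω, (∑' j : ℕ, if 8 * L ≤ 2 ^ j then 𝒇⟦e, L, j, ω⟧ else 0) ∂μ ≤
      ENNReal.ofReal (Kf * (1 - z)⁻¹) := by
    refine lintegral_tsum_le_of_geom _ (measurable_far e L) hKf hz0 hz1 (fun j => ?_)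
    by_cases hj : 8 * L ≤ 2 ^ j
    · simp only [if_pos hj]
      exact hfar j hj
    · simp only [if_neg hj, lintegral_zero]
      exact zero_le
  have h1 : 0 ≤ (1 - x)⁻¹ := inv_nonneg.2 (by linarith)
  have h2 : 0 ≤ (1 - z)⁻¹ := inv_nonneg.2 (by linarith)
  rw [sum_tsum_measure_eq_lintegral μ e]
  refine (lintegral_mono fun ω => hcount ω).trans ?_
  rw [lintegral_add_left (Finset.measurable_sum _ fun j _ => measurable_near e L j)]
  refine (add_le_add hn hf).trans_eq ?_
  exact (ENNReal.ofReal_add (by positivity) (by positivity)).symm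

end PairExpectation

open PairExpectation in
/-- **stub_pairExpectation (Markov bookkeeping of the window pair count)**: given the
deterministic dyadic bound `hcount` of the pair count, there is `C = C(κ, C₁, C₂)` such that for
every floor density `s` and floor neighbour `e` of `0` satisfying the two-arm bound
`P_s(A(r)) ≤ C₁ r^{-(11/4+κ)}` and the exponential mass tails
`P_s(m_x(n) ≥ t C₂ n^{11/4}) ≤ e^{3/2} e^{-t/2}` (`x ∈ {0, e}`), the expected window pair count is
`Σ_{w ∈ W_L} Σ_{v₀ ≥ 1} P_s(0 ↔_ℍ v, e ↔_ℍ v + w, 0 ↮_ℍ e) ≤ C L^{3-κ/2}` for all `L ≥ 1`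
(Tonelli, Markov truncation of each dyadic class at level `t C₂ n^{11/4}` with `t = O(log)`,
geometric sums; the logarithms are absorbed by `κ ≤ 1/4`). -/
theorem stub_pairExpectation :
    ∀ κ C₁ C₂ : ℝ, 0 < κ → κ ≤ 1 / 4 → 0 ≤ C₁ → 0 < C₂ →
      (∀ e ∈ ({Pi.single 1 1, Pi.single 1 (-1), Pi.single 2 1, Pi.single 2 (-1)} : Finset (Site 3)), ∀ L : ℕ, 1 ≤ L → ∀ ω : BondConfig (Site 3),
        (∑ w ∈ ((box 3 L).image fun y : Site 3 => y + Pi.single 0 (((2 * L : ℕ)) : ℤ)), ∑' v : {v : Site 3 // 1 ≤ v 0}, (openConnIn {x : Site 3 | 0 ≤ x 0} 0 (v : Site 3) ∩ openConnIn {x : Site 3 | 0 ≤ x 0} e ((v : Site 3) + w) ∩ (openConnIn {x : Site 3 | 0 ≤ x 0} 0 e)ᶜ).indicator (fun _ => (1 : ℝ≥0∞)) ω)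
          ≤ (∑ j ∈ Finset.range (8 * L), if 2 ^ j < 8 * L then (((↑(box 3 (2 ^ (j + 1))) : Set (Site 3)) ∩ {y : Site 3 | ω ∈ openConnIn {x : Site 3 | 0 ≤ x 0} 0 y}).ncard : ℝ≥0∞) * (((↑(box 3 (20 * L)) : Set (Site 3)) ∩ {y : Site 3 | ω ∈ openConnIn {x : Site 3 | 0 ≤ x 0} e (e + y)}).ncard : ℝ≥0∞) * ({ω | ∃ y : Site 3, (∃ i : Fin 3, ((min (2 ^ j) L : ℕ) : ℤ) ≤ |y i|) ∧ ω ∈ openConnIn {x : Site 3 | 0 ≤ x 0} 0 y} ∩ {ω | ∃ y : Site 3, (∃ i : Fin 3, ((min (2 ^ j) L : ℕ) : ℤ) ≤ |y i - e i|) ∧ ω ∈ openConnIn {x : Site 3 | 0 ≤ x 0} e y} ∩ (openConnIn {x : Site 3 | 0 ≤ x 0} 0 e)ᶜ).indicator (fun _ => (1 : ℝ≥0∞)) ω else 0)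
            + (∑' j : ℕ, if 8 * L ≤ 2 ^ j then (((↑(box 3 (2 ^ (j + 1))) : Set (Site 3)) ∩ {y : Site 3 | ω ∈ openConnIn {x : Site 3 | 0 ≤ x 0} 0 y}).ncard : ℝ≥0∞) * ((((box 3 L).image fun y : Site 3 => y + Pi.single 0 (((2 * L : ℕ)) : ℤ))).card : ℝ≥0∞) * ({ω | ∃ y : Site 3, (∃ i : Fin 3, ((2 ^ (j - 1) : ℕ) : ℤ) ≤ |y i|) ∧ ω ∈ openConnIn {x : Site 3 | 0 ≤ x 0} 0 y} ∩ {ω | ∃ y : Site 3, (∃ i : Fin 3, ((2 ^ (j - 1) : ℕ) : ℤ) ≤ |y i - e i|) ∧ ω ∈ openConnIn {x : Site 3 | 0 ≤ x 0} e y} ∩ (openConnIn {x : Site 3 | 0 ≤ x 0} 0 e)ᶜ).indicator (fun _ => (1 : ℝ≥0∞)) ω else 0)) →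
      ∃ C : ℝ, ∀ s : unitInterval, ∀ e ∈ ({Pi.single 1 1, Pi.single 1 (-1), Pi.single 2 1, Pi.single 2 (-1)} : Finset (Site 3)),
        (∀ r : ℕ, 1 ≤ r →
          (floorDilutedPercolation 3 (criticalProbI 3) s).real
            ({ω | ∃ y : Site 3, (∃ i : Fin 3, ((r : ℕ) : ℤ) ≤ |y i|) ∧ ω ∈ openConnIn {x : Site 3 | 0 ≤ x 0} 0 y} ∩ {ω | ∃ y : Site 3, (∃ i : Fin 3, ((r : ℕ) : ℤ) ≤ |y i - e i|) ∧ ω ∈ openConnIn {x : Site 3 | 0 ≤ x 0} e y} ∩ (openConnIn {x : Site 3 | 0 ≤ x 0} 0 e)ᶜ) ≤ C₁ * (r : ℝ) ^ (-(11 / 4 + κ))) →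
        (∀ x ∈ ({0, e} : Finset (Site 3)), ∀ n : ℕ, 1 ≤ n → ∀ t : ℝ, 1 ≤ t →
          (floorDilutedPercolation 3 (criticalProbI 3) s).real
            {ω | t * (C₂ * (n : ℝ) ^ ((11 : ℝ) / 4)) ≤ (((↑(box 3 (n)) : Set (Site 3)) ∩ {y : Site 3 | ω ∈ openConnIn {x : Site 3 | 0 ≤ x 0} x (x + y)}).ncard : ℝ)}
              ≤ Real.exp (3 / 2) * Real.exp (-t / 2)) →
        ∀ L : ℕ, 1 ≤ L →
          ∑ w ∈ ((box 3 L).image fun y : Site 3 => y + Pi.single 0 (((2 * L : ℕ)) : ℤ)), ∑' v : {v : Site 3 // 1 ≤ v 0},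
              floorDilutedPercolation 3 (criticalProbI 3) s
                (openConnIn {x : Site 3 | 0 ≤ x 0} 0 (v : Site 3) ∩ openConnIn {x : Site 3 | 0 ≤ x 0} e ((v : Site 3) + w) ∩ (openConnIn {x : Site 3 | 0 ≤ x 0} 0 e)ᶜ)
            ≤ ENNReal.ofReal (C * (L : ℝ) ^ (3 - κ / 2)) := by
  intro κ C₁ C₂ hκ hκ4 hC₁ hC₂ hcount
  -- the constant `C = K_near / (1 - 2^{-κ}) + K_far / (1 - 2^{-κ/4})`
  refine ⟨(2 * 161 ^ 2 * (16 : ℝ) ^ ((11 : ℝ) / 4) * (20 : ℝ) ^ ((11 : ℝ) / 4) *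
        C₁ * C₂ ^ 2 + 4 * Real.exp (3 / 2) * 33 ^ 3 * 41 ^ 3) * (1 - (2 : ℝ) ^ (-κ))⁻¹ +
      (2 * (36 * 28 * (4 : ℝ) ^ ((11 : ℝ) / 4) * C₁ * C₂ / κ + 729 * 27 * Real.exp (3 / 2))) *
        (1 - (2 : ℝ) ^ (-κ / 4))⁻¹, fun s e he hA hT L hL => ?_⟩
  have hx1 : (2 : ℝ) ^ (-κ) < 1 :=
    Real.rpow_lt_one_of_one_lt_of_neg (by norm_num) (by linarith)
  have hz1 : (2 : ℝ) ^ (-κ / 4) < 1 :=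
    Real.rpow_lt_one_of_one_lt_of_neg (by norm_num) (by linarith)
  have hT0 : ∀ n : ℕ, 1 ≤ n → ∀ t : ℝ, 1 ≤ t →
      (floorDilutedPercolation 3 (criticalProbI 3) s).real
          {ω | t * (C₂ * (n : ℝ) ^ ((11 : ℝ) / 4)) ≤ ((𝑪₀⟦ω, n⟧).ncard : ℝ)} ≤
        Real.exp (3 / 2) * Real.exp (-t / 2) := by
    intro n hn t ht
    have h := hT 0 (by simp) n hn t ht
    simpa only [zero_add] using h
  have key := expectation_le_of_classes (floorDilutedPercolation 3 (criticalProbI 3) s) e L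
    (by positivity) (by positivity) (by positivity) hx1 (by positivity) hz1
    (fun j hj => near_class_le hκ hκ4 hC₁ hC₂ _ e hA hT0 hL
      (fun n hn t ht => hT e (by simp) n hn t ht) hj)
    (fun j hj => far_class_le hκ hκ4 hC₁ hC₂ _ e hA hT0 hL hj) (hcount e he L hL)
  refine key.trans (le_of_eq ?_)
  congr 1
  ring

end Summit.CriticalPhenomena.PercolationContinuityZ3.Theorems.FloorRusso

end
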